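import HarnessLib
import Summits.ValiantsHypothesis.Statement
import Summits.ValiantsHypothesis.ValiantsHypothesis.Theorems.SuccinctLiftLefschetz
import Summits.ValiantsHypothesis.ValiantsHypothesis.Theorems.DepthWindowBinarisation
import Literature.Computability.AlgebraicComplexity.CircuitDepthProofs

/-!
# ValiantsHypothesis — ArithmeticDescent II (prime notch), part 1/3: the Lefschetz principle for
# the fan-in-two complexity `L(per_n)` at one `n` (kernel, route-independent)

Decomposition workshop `decomp-valiant`, lens 2, generation 13.  Bookkeeping for the prime-notch file
`ArithmeticDescentPrimes.lean`: `productDepth_le_size` (product-depth ≤ number of gates), escaping a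
polynomial bound at arbitrarily large `n` (`exists_ge_lt_of_not_isPBounded`), and
`complexity_perPoly_complex_le_of_charSpread`: if for every `N ≠ 0` some field in which `N ≠ 0` has
`L_F(per_n) ≤ s`, then `L_ℂ(per_n) ≤ 4s` (the tree's compactness-over-skeletons theorem
`SuccinctLift.exists_complexCircuit_perPoly_of_charSpread` + wire binarisation
`DepthWindow.complexity_eval_le_two_mul_edgeSize`).  All sorry-free.
-/

noncomputable section
set_option linter.dupNamespace false

open MvPolynomial
open Literature.Computability.AlgebraicComplexity

namespace Summit.ValiantsHypothesis.ValiantsHypothesis.Theorems.ArithmeticDescent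

/-! ### §0 Bookkeeping: product-depth is at most size; escaping a polynomial bound -/

/-- The maximum of a mapped list is bounded by a common bound of the values. [folklore] -/
theorem foldr_max_map_le {α : Type*} (l : List α) {f : α → ℕ} {B : ℕ}
    (h : ∀ a ∈ l, f a ≤ B) : (l.map f).foldr max 0 ≤ B := by
  induction l with
  | nil => exact Nat.zero_le _
  | cons a l ih =>
    simp only [List.map_cons, List.foldr_cons]
    exact max_le (h a List.mem_cons_self) (ih fun b hb => h b (List.mem_cons_of_mem a hb))

/-- The depth of an operand is bounded by a common bound of the gate depths. [cite: LST2021, §2] -/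
theorem depthIn_le {k : Type*} {σ : Type*} {ds : List ℕ} {B : ℕ} (h : ∀ j : ℕ, ds.getD j 0 ≤ B)
    (u : ArithCircuit.Operand k σ) : u.depthIn ds ≤ B := by
  cases u with
  | var i => exact Nat.zero_le _
  | const c => exact Nat.zero_le _
  | gate j => exact h j

/-- With gate weights `≤ 1`, every weighted gate depth is at most the number of gates. [cite: LST2021, §2] -/
theorem gateWDepths_getD_le_length {k : Type*} {σ : Type*} {w : ArithCircuit.Gate k σ → ℕ}
    (hw : ∀ g, w g ≤ 1) (gs : List (ArithCircuit.Gate k σ)) (j : ℕ) :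
    (ArithCircuit.gateWDepths w gs).getD j 0 ≤ gs.length := by
  induction gs using List.reverseRecOn generalizing j with
  | nil => simp [ArithCircuit.gateWDepths]
  | append_singleton gs g ih =>
    rw [ArithCircuit.gateWDepths_append_singleton, List.length_append, List.length_singleton]
    rcases lt_or_ge j gs.length with hj | hj
    · rw [List.getD_append _ _ _ _ (by rwa [ArithCircuit.gateWDepths_length])]
      exact (ih j).trans (Nat.le_succ _)
    · rw [List.getD_append_right _ _ _ _ (by rwa [ArithCircuit.gateWDepths_length])]
      rcases Nat.eq_zero_or_pos (j - gs.length) with h0 | hpos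
      · simp only [ArithCircuit.gateWDepths_length, h0, List.getD_cons_zero]
        rw [Nat.add_comm gs.length 1]
        exact Nat.add_le_add (hw g) (foldr_max_map_le _ fun u _ => depthIn_le ih u)
      · obtain ⟨m, hm⟩ := Nat.exists_eq_succ_of_ne_zero hpos.ne'
        simp [ArithCircuit.gateWDepths_length, hm]

/-- With gate weights `≤ 1`, the weighted depth of a circuit is at most its size. [cite: LST2021, §2] -/
theorem wdepth_le_size {k : Type*} {σ : Type*} {w : ArithCircuit.Gate k σ → ℕ} (hw : ∀ g, w g ≤ 1)
    (P : ArithCircuit k σ) : P.wdepth w ≤ P.size :=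
  depthIn_le (gateWDepths_getD_le_length hw P.gates) P.output

/-- The product-depth of a circuit is at most its size (number of gates). [cite: LimayeSrinivasanTavenas2021, §1] -/
theorem productDepth_le_size {k : Type*} {σ : Type*} (P : ArithCircuit k σ) :
    P.productDepth ≤ P.size :=
  wdepth_le_size (fun g => by cases g <;> simp [ArithCircuit.Gate.isProd]) P

/-- A function that is not p-bounded exceeds `a·(n^c + c)` at arbitrarily large `n`. [cite: Burgisser2000, Def. 2.1(1)] -/
theorem exists_ge_lt_of_not_isPBounded {t : ℕ → ℕ} (ht : ¬ IsPBounded t) (a c n₀ : ℕ) :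
    ∃ n, n₀ ≤ n ∧ a * (n ^ c + c) < t n := by
  by_contra h
  push Not at h
  apply ht
  have h1 : IsPBounded (fun n : ℕ => n ^ c + c) := ⟨c, fun _ => le_rfl⟩
  have hB : IsPBounded fun n => a * (n ^ c + c) + ∑ i ∈ Finset.range n₀, t i :=
    IsPBounded.add_holds (IsPBounded.mul_holds (IsPBounded.const a) h1) (IsPBounded.const _)
  refine hB.mono fun n => ?_
  rcases Nat.lt_or_ge n n₀ with hn | hn
  · exact (Finset.single_le_sum (fun i _ => Nat.zero_le (t i)) (Finset.mem_range.2 hn)).trans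
      (Nat.le_add_left _ _)
  · exact (h n hn).trans (Nat.le_add_right _ _)

/-! ### §1 The Lefschetz principle for fan-in-two complexity at one `n` -/

/-- **Lefschetz for `L(per_n)`.**  If for every `N ≠ 0` some field `F` with `N ≠ 0` in `F` has
`L_F(per_n) ≤ s`, then `L_ℂ(per_n) ≤ 4s` (an optimal `F`-circuit has product-depth `≤ s` and `≤ 2s`
wires; the tree's compactness-over-skeletons theorem gives a `ℂ`-circuit with `≤ 2s` wires, hence
fan-in-two complexity `≤ 4s`). [cite: Burgisser2000, §4.1] -/
theorem complexity_perPoly_complex_le_of_charSpread (n s : ℕ)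
    (h : ∀ N : ℕ, N ≠ 0 → ∃ (F : Type) (_ : Field F), (N : F) ≠ 0 ∧
      complexity (perPoly (Fin n) F) ≤ s) :
    complexity (perPoly (Fin n) ℂ) ≤ 4 * s := by
  obtain ⟨C, hC, -, hE⟩ :=
    SuccinctLift.exists_complexCircuit_perPoly_of_charSpread n s (2 * s) fun N hN => by
      obtain ⟨F, instF, hNF, hs⟩ := h N hN
      obtain ⟨P, h2, hPc, hPs⟩ :=
        ArithCircuit.exists_computes_size_eq_complexity (perPoly (Fin n) F)
      refine ⟨F, instF, hNF, P, hPc, ?_, ?_⟩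
      · exact (productDepth_le_size P).trans (hPs ▸ hs)
      · exact (ArithCircuit.edgeSize_le_two_mul_size_holds h2).trans
          (Nat.mul_le_mul_left 2 (hPs ▸ hs))
  rw [ArithCircuit.Computes] at hC
  calc complexity (perPoly (Fin n) ℂ) = complexity C.eval := by rw [hC]
    _ ≤ 2 * C.edgeSize := DepthWindow.complexity_eval_le_two_mul_edgeSize C
    _ ≤ 2 * (2 * s) := Nat.mul_le_mul_left 2 hE
    _ = 4 * s := by ring

end Summit.ValiantsHypothesis.ValiantsHypothesis.Theorems.ArithmeticDescent

end
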